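import Literature.AnabelianGeometry.EtaleTheta.ProfiniteAbelianZHatPow
import Literature.AnabelianGeometry.SemiGraphs.TemperedCompletionOpenSubgroups
import Mathlib.Data.ZMod.QuotientGroup
import HarnessLib

/-!
# `Ẑ`-powers in a profinite abelian group are UNIFORMLY locally constant in the exponent modulo every open subgroup
# (support file for [EtTh] Rmk 1.6.4 (c2) in its `Ẑ`-form; piece (Z4b) of abc-iut «RMK164-ZHAT»)

Ribes–Zalesskii, *Profinite Groups*, §4.1 (`Ẑ`-powers in profinite groups) [cite: RibesZalesskii2010, §4.1]; used for
Mochizuki, *The étale theta function …*, Publ. RIMS **45** (2009) [EtTh], Remark 1.6.4 p. 252 («… on which any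
`Π_X/Π_{Y^∧} ≅ Ẑ ∋ a` acts via …») [cite: MochizukiEtTh2009, Rmk 1.6.4 p.252] — the passage from `a ∈ ℤ` to `a ∈ Ẑ`
(abc-iut-L2-lead gen 9 R1364/R1371: (Z3) = abc-iut-L2-t12's `ProfiniteZHatPow.powZHat`/`zhatPow`, p514999; (Z4b) = this).

PROOF-ONLY (abc-iut cell, prover abc-iut-f-128 gen 8; no definitions, no facts).  For a profinite ABELIAN group `M`
(compact, totally disconnected, commutative topological group) and an OPEN subgroup `U ≤ M`:
* `exists_openNormalSubgroup_forall_powZHat_mem` — there is an open (normal) subgroup `V ≤ Ẑ` (`Ẑ` = abc-iut-f-142's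
  `ThetaSetting.ZHat`) such that `m^ĉ ∈ U` for EVERY `ĉ ∈ V` and EVERY `m ∈ M` — UNIFORMLY in `m` with no joint-continuity
  argument: `n := [M : U]`, `mⁿ ∈ U`; `V` = the open normal subgroup of `Ẑ` cutting out `nℤ` ([SemiAnbd] §6
  `IsProfiniteCompletion.comap_surjective` for `η : ℤ → Ẑ`, abc-iut-f-142's `isProfiniteCompletion_etaZ`); `V` is the
  closure of `η(nℤ)` (`IsProfiniteCompletion.closure_image_comap`), which `ĉ ↦ m^ĉ` (continuous) maps into the closed `U`;
* `forall_powZHat_congr` / `forall_zhatPow_congr` — hence for `â b̂⁻¹ ∈ V`: `m^â ≡ m^b̂ (mod U)` for all `m`, i.e. the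
  exponent map `â ↦ (m ↦ m^â)` is constant modulo `U` on the cosets of `V`, uniformly in `m`.
v2 (append, §2): the exponents `−2â := (â·â)⁻¹`, `−â² := (â ⋆ â)⁻¹` (`⋆ = powZHat`, the ring product of `Ẑ`) move
congruentially with `â` — `continuous_powZHat_left_zhat`, `powZHat_comm` (`â ⋆ b̂ = b̂ ⋆ â`), `mul_self_mul_inv_mem`,
`powZHat_self_mul_inv_mem`, `forall_zhatPow_negTwo_negSq_congr` (`ĉâ⁻¹ ∈ V ⟹ m^(−2ĉ) ≡_U m^(−2â)`, `m^(−ĉ²) ≡_U m^(−â²)`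
for all `m`).
Mathlib + the cited tree files only.  Nothing here bears on [IUTchIII] Cor. 3.12.
-/

noncomputable section

namespace Literature.AnabelianGeometry.EtaleTheta

namespace ProfiniteZHatPow

open Topology
open Literature.AnabelianGeometry.SemiGraphs

universe u

variable {M : Type u} [CommGroup M] [TopologicalSpace M] [IsTopologicalGroup M] [CompactSpace M]
  [TotallyDisconnectedSpace M]

/-- **`Ẑ`-powers are uniformly locally constant in the exponent modulo an open subgroup**: for an open subgroup `U`
of the profinite abelian group `M` there is an open normal subgroup `V ≤ Ẑ` with `m^ĉ ∈ U` for every `ĉ ∈ V` and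
every `m ∈ M` (`V` cuts out `nℤ ⊆ ℤ`, `n = [M : U]`, and is the closure of `η(nℤ)`; `mⁿ ∈ U`).
[cite: RibesZalesskii2010, §4.1] -/
theorem exists_openNormalSubgroup_forall_powZHat_mem (U : Subgroup M) (hU : IsOpen (U : Set M)) :
    ∃ V : OpenNormalSubgroup ThetaSetting.ZHat, ∀ c ∈ V.toSubgroup, ∀ m : M, powZHat m c ∈ U := by
  classical
  -- `n := [M : U] > 0`, `mⁿ ∈ U`
  haveI : Finite (M ⧸ U) := Subgroup.quotient_finite_of_isOpen U hU
  haveI : U.FiniteIndex := Subgroup.finiteIndex_of_finite_quotient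
  have hn : U.index ≠ 0 := Subgroup.FiniteIndex.index_ne_zero
  -- the open normal finite-index subgroup `nℤ` of the discrete group `ℤ`
  let K : Subgroup (Multiplicative ℤ) := AddSubgroup.toSubgroup (AddSubgroup.zmultiples (U.index : ℤ))
  haveI hKfi : K.FiniteIndex := by
    refine ⟨?_⟩
    change (AddSubgroup.toSubgroup (AddSubgroup.zmultiples (U.index : ℤ))).index ≠ 0
    rw [AddSubgroup.index_toSubgroup, Int.index_zmultiples, Int.natAbs_natCast]
    exact hn
  let KO : OpenNormalSubgroup (Multiplicative ℤ) :=
    { toSubgroup := K, isOpen' := isOpen_discrete _, isNormal' := inferInstance }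
  obtain ⟨V, hV⟩ := ThetaSetting.isProfiniteCompletion_etaZ.comap_surjective KO hKfi
  refine ⟨V, fun c hc m => ?_⟩
  -- `V` is the closure of `η(nℤ)`
  have hcl := IsProfiniteCompletion.closure_image_comap ThetaSetting.isProfiniteCompletion_etaZ V
  have hKV : ((KO.toSubgroup : Subgroup (Multiplicative ℤ)) : Set (Multiplicative ℤ)) =
      ((V.toSubgroup.comap ThetaSetting.etaZ.toMonoidHom : Subgroup (Multiplicative ℤ)) : Set (Multiplicative ℤ)) := by
    rw [hV]
  have hc' : c ∈ closure (ThetaSetting.etaZ '' ((KO.toSubgroup : Subgroup (Multiplicative ℤ)) :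
      Set (Multiplicative ℤ))) := by
    rw [hKV, hcl]
    exact hc
  -- `ĉ ↦ m^ĉ` maps `η(nℤ)` into the closed `U`
  have hUcl : IsClosed (U : Set M) := Subgroup.isClosed_of_isOpen U hU
  have hsub : ThetaSetting.etaZ '' ((KO.toSubgroup : Subgroup (Multiplicative ℤ)) : Set (Multiplicative ℤ)) ⊆
      powZHat m ⁻¹' (U : Set M) := by
    rintro _ ⟨k, hk, rfl⟩
    rw [Set.mem_preimage, SetLike.mem_coe, powZHat_etaZ]
    have hk' : Multiplicative.toAdd k ∈ AddSubgroup.zmultiples (U.index : ℤ) :=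
      (Multiplicative.mem_toSubgroup _ _).mp hk
    obtain ⟨j, hj⟩ := AddSubgroup.mem_zmultiples_iff.mp hk'
    rw [← hj, smul_eq_mul, mul_comm, zpow_mul, zpow_natCast]
    exact U.zpow_mem (U.pow_index_mem m) j
  have hclsub : closure (ThetaSetting.etaZ '' ((KO.toSubgroup : Subgroup (Multiplicative ℤ)) :
      Set (Multiplicative ℤ))) ⊆ powZHat m ⁻¹' (U : Set M) :=
    closure_minimal hsub (hUcl.preimage (powZHat m).continuous)
  exact hclsub hc'

/-- **Congruence of `Ẑ`-powers for nearby exponents**: with `V` as above, `â·b̂⁻¹ ∈ V` implies `m^â · (m^b̂)⁻¹ ∈ U` for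
every `m` (`m^â (m^b̂)⁻¹ = m^(â b̂⁻¹)`). [cite: RibesZalesskii2010, §4.1] -/
theorem forall_powZHat_congr (U : Subgroup M) (hU : IsOpen (U : Set M)) :
    ∃ V : OpenNormalSubgroup ThetaSetting.ZHat, ∀ a b : ThetaSetting.ZHat, a * b⁻¹ ∈ V.toSubgroup →
      ∀ m : M, powZHat m a * (powZHat m b)⁻¹ ∈ U := by
  obtain ⟨V, hV⟩ := exists_openNormalSubgroup_forall_powZHat_mem U hU
  refine ⟨V, fun a b hab m => ?_⟩
  rw [← map_inv, ← map_mul]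
  exact hV _ hab m

/-- The same for abc-iut-L2-t12's endomorphisms `zhatPow â : M →ₜ* M`: `â·b̂⁻¹ ∈ V ⟹ zhatPow â m · (zhatPow b̂ m)⁻¹ ∈ U`
for every `m` — the exponent map is constant modulo `U` on the cosets of `V`, UNIFORMLY in `m`.
[cite: RibesZalesskii2010, §4.1] [cite: MochizukiEtTh2009, Rmk 1.6.4 p.252] -/
theorem forall_zhatPow_congr (U : Subgroup M) (hU : IsOpen (U : Set M)) :
    ∃ V : OpenNormalSubgroup ThetaSetting.ZHat, ∀ a b : ThetaSetting.ZHat, a * b⁻¹ ∈ V.toSubgroup →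
      ∀ m : M, zhatPow a m * (zhatPow b m)⁻¹ ∈ U := by
  obtain ⟨V, hV⟩ := forall_powZHat_congr U hU
  exact ⟨V, fun a b hab m => by simpa only [zhatPow_apply] using hV a b hab m⟩

/-! ### §2 (v2, append). The exponents `−2â := (â·â)⁻¹` and `−â² := (â ⋆ â)⁻¹` move congruentially with `â`

For the (Z5b) assembly of [EtTh] Rmk 1.6.4 (c2) in `Ẑ`-form (powers `L̂^(−2â)`, `Q̂^(−â²)`;
[cite: MochizukiEtTh2009, Rmk 1.6.4 p.252]): in the multiplicatively written `Ẑ = ThetaSetting.ZHat` (group law =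
addition of `Ẑ`; `⋆ := powZHat`, its ring product, cf. abc-iut-L2-t12's `powZHat_powZHat`) one needs, for an open normal
`V ≤ Ẑ`: `ĉ·â⁻¹ ∈ V ⟹ (ĉ·ĉ)·(â·â)⁻¹ ∈ V` and `(ĉ ⋆ ĉ)·(â ⋆ â)⁻¹ ∈ V`, whence (§1) `m^(−2ĉ) ≡_U m^(−2â)` and
`m^(−ĉ²) ≡_U m^(−â²)` uniformly in `m`.  `Ẑ` carries no `CommGroup` INSTANCE in the tree (its commutativity is the theorem
`ZHatCompletion.mul_comm`), so the two `Ẑ`-specific items `continuous_powZHat_left_zhat`, `powZHat_comm` are proved directly. -/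

/-- `â ↦ â ⋆ b̂` is continuous on `Ẑ`: it is a homomorphism (`powZHat_mul_left_zhat`) mapping each open normal subgroup into
itself (`powZHat_mem_of_isClosed`) — the argument of abc-iut-L2-t12's `continuous_powZHat_left`, whose statement asks for a
`CommGroup` instance that `Ẑ` does not carry. [cite: RibesZalesskii2010, §4.1] -/
theorem continuous_powZHat_left_zhat (b : ThetaSetting.ZHat) :
    Continuous fun a : ThetaSetting.ZHat => powZHat a b := by
  let F : ThetaSetting.ZHat →* ThetaSetting.ZHat :=
    { toFun := fun a => powZHat a b, map_one' := powZHat_one_left b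
      map_mul' := fun a c => powZHat_mul_left_zhat a c b }
  refine continuous_of_continuousAt_one F ?_
  rw [ContinuousAt, map_one]
  intro W hW
  obtain ⟨U, hUW, hUo, h1U⟩ := mem_nhds_iff.mp hW
  obtain ⟨N, hN⟩ := ProfiniteGrp.exist_openNormalSubgroup_sub_open_nhds_of_one hUo h1U
  rw [Filter.mem_map]
  refine Filter.mem_of_superset (N.toOpenSubgroup.isOpen.mem_nhds N.toOpenSubgroup.one_mem) fun a ha => ?_
  exact hUW (hN (powZHat_mem_of_isClosed N.toOpenSubgroup.isClosed ha b))

/-- **Commutativity of the `Ẑ`-product**: `â ⋆ b̂ = b̂ ⋆ â` (`b̂ ↦ b̂ ⋆ â` is a continuous homomorphism `Ẑ → Ẑ` taking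
`η 1 ↦ â` by `powZHat_etaZ_left`, hence equals `powZHat â` by `powZHat_unique`). [cite: RibesZalesskii2010, §4.1] -/
theorem powZHat_comm (a b : ThetaSetting.ZHat) : powZHat a b = powZHat b a := by
  let Ψ : ThetaSetting.ZHat →ₜ* ThetaSetting.ZHat :=
    { toFun := fun x => powZHat x a
      map_one' := powZHat_one_left a
      map_mul' := fun x y => powZHat_mul_left_zhat x y a
      continuous_toFun := continuous_powZHat_left_zhat a }
  have h : Ψ = powZHat a :=
    powZHat_unique a Ψ (by
      change powZHat (ThetaSetting.etaZ (Multiplicative.ofAdd 1)) a = a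
      rw [powZHat_etaZ_left, toAdd_ofAdd, zpow_one])
  exact (DFunLike.congr_fun h b).symm

/-- `x·y⁻¹ ∈ V ⟹ x⁻¹·(y⁻¹)⁻¹ ∈ V` for a normal subgroup `V` (`x⁻¹ y = x⁻¹ (x y⁻¹)⁻¹ x`): congruence passes to inverses —
the shape `forall_zhatPow_congr` consumes for the NEGATED exponents. [cite: RibesZalesskii2010, §4.1] -/
theorem inv_mul_inv_inv_mem {G : Type*} [Group G] {V : Subgroup G} [V.Normal] {x y : G} (h : x * y⁻¹ ∈ V) :
    x⁻¹ * y⁻¹⁻¹ ∈ V := by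
  have h1 : x⁻¹ * (x * y⁻¹)⁻¹ * x⁻¹⁻¹ ∈ V := Subgroup.Normal.conj_mem ‹_› _ (V.inv_mem h) x⁻¹
  have e : x⁻¹ * y⁻¹⁻¹ = x⁻¹ * (x * y⁻¹)⁻¹ * x⁻¹⁻¹ := by group
  rw [e]
  exact h1

/-- **`−2a` moves with `a`**: `ĉ·â⁻¹ ∈ V ⟹ (ĉ·ĉ)·(â·â)⁻¹ ∈ V` for a normal subgroup `V`
(`ĉĉâ⁻¹â⁻¹ = (ĉ(ĉâ⁻¹)ĉ⁻¹)·(ĉâ⁻¹)`; no commutativity needed). [cite: RibesZalesskii2010, §4.1] -/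
theorem mul_self_mul_inv_mem {G : Type*} [Group G] {V : Subgroup G} [V.Normal] {c a : G} (h : c * a⁻¹ ∈ V) :
    c * c * (a * a)⁻¹ ∈ V := by
  have h1 : c * (c * a⁻¹) * c⁻¹ ∈ V := Subgroup.Normal.conj_mem ‹_› _ h c
  have e : c * c * (a * a)⁻¹ = c * (c * a⁻¹) * c⁻¹ * (c * a⁻¹) := by group
  rw [e]
  exact V.mul_mem h1 h

/-- **`−a²` moves with `a`**: for an open normal subgroup `V ≤ Ẑ`, `ĉ·â⁻¹ ∈ V ⟹ (ĉ ⋆ ĉ)·(â ⋆ â)⁻¹ ∈ V`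
(`(ĉ⋆ĉ)·(â⋆â)⁻¹ = ((ĉâ⁻¹) ⋆ ĉ)·(â ⋆ (ĉâ⁻¹))` by the two distributivities, and the closed subgroup `V` is stable under
`⋆` with anything on either side: `powZHat_mem_of_isClosed` and `powZHat_comm`). [cite: RibesZalesskii2010, §4.1] -/
theorem powZHat_self_mul_inv_mem (V : OpenNormalSubgroup ThetaSetting.ZHat) {c a : ThetaSetting.ZHat}
    (h : c * a⁻¹ ∈ V.toSubgroup) : powZHat c c * (powZHat a a)⁻¹ ∈ V.toSubgroup := by
  have hVcl : IsClosed ((V.toSubgroup : Subgroup ThetaSetting.ZHat) : Set ThetaSetting.ZHat) :=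
    V.toOpenSubgroup.isClosed
  have e1 : powZHat c c = powZHat (c * a⁻¹) c * powZHat a c := by
    rw [← powZHat_mul_left_zhat, inv_mul_cancel_right]
  have e2 : powZHat a c = powZHat a (c * a⁻¹) * powZHat a a := by
    rw [← map_mul, inv_mul_cancel_right]
  rw [e1, e2, ← mul_assoc, mul_inv_cancel_right]
  refine V.toSubgroup.mul_mem (powZHat_mem_of_isClosed hVcl h c) ?_
  rw [powZHat_comm]
  exact powZHat_mem_of_isClosed hVcl h a

/-- **The exponents of [EtTh] Rmk 1.6.4 (c2) are uniformly congruence-continuous in `â`**: for an open subgroup `U` of the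
profinite abelian group `M` there is an open normal `V ≤ Ẑ` such that `ĉ·â⁻¹ ∈ V` implies, for EVERY `m ∈ M`,
`m^(−2ĉ) ≡ m^(−2â)` and `m^(−ĉ²) ≡ m^(−â²)` modulo `U` — with `−2â := (â·â)⁻¹`, `−â² := (â ⋆ â)⁻¹` in the multiplicatively
written `Ẑ`. [cite: RibesZalesskii2010, §4.1] [cite: MochizukiEtTh2009, Rmk 1.6.4 p.252] -/
theorem forall_zhatPow_negTwo_negSq_congr (U : Subgroup M) (hU : IsOpen (U : Set M)) :
    ∃ V : OpenNormalSubgroup ThetaSetting.ZHat, ∀ c a : ThetaSetting.ZHat, c * a⁻¹ ∈ V.toSubgroup → ∀ m : M,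
      zhatPow (c * c)⁻¹ m * (zhatPow (a * a)⁻¹ m)⁻¹ ∈ U ∧
        zhatPow (powZHat c c)⁻¹ m * (zhatPow (powZHat a a)⁻¹ m)⁻¹ ∈ U := by
  obtain ⟨V, hV⟩ := forall_zhatPow_congr U hU
  exact ⟨V, fun c a h m =>
    ⟨hV _ _ (inv_mul_inv_inv_mem (mul_self_mul_inv_mem h)) m,
      hV _ _ (inv_mul_inv_inv_mem (powZHat_self_mul_inv_mem V h)) m⟩⟩

end ProfiniteZHatPow

end Literature.AnabelianGeometry.EtaleTheta

end
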